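import Summits.QuantumFields.BalabanUV.T4Continuum.Support.SubstrateChartRealSlice

/-!
# SUBSTRATE — [dict] D-8 ∕ LIBRARY L-E12 = W-17 (typer gen 9 RULING (λ13), journal l.17637): THE REAL-SLICE DISC ON THE TWO-RUN CHART `TwoRunChart D o`
# (located shape INFO-1 of substrate-p2 g4's XREAD of p225653, journal l.17081): ONE disc `sliceDisc₂` through a pair of chart points with BOTH factors' real
# diameters unitary, and the seven-clause `hslice` package of `OutputRateComplexSlice.operatorRate_complex_of_realSlice_each` at `𝒰 := TwoRunChart D o`,
# `real := unitaryLev₂ D` — the shape forced by the section of record `sectionOfRecord D ι : C.BgB → TwoRunChart D o`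

Cell `pub-balaban`, SUBSTRATE cell, seat `b2b-balaban-substrate-p1` (gen 4).  Summits-side under the LEAN PLACEMENT RULE.  Follower of `SubstrateChartRealSlice`
(p225653: `sliceArg`, `sliceDisc`, `sliceDisc_I_mul`, `sliceDisc_ofReal_mem_unitaryLev`, `diffContOnCl_comp_sliceArg`, `norm_comp_sliceArg_le`, `chi_sliceDisc`,
`unitaryLev₂`, `sectionOfRecord_mem_unitaryLev₂`) BY NAME; nothing restated.

WHY THE PAIR.  NE5's Road-D-ℂ ENDs (`OutputRateFunctionalTablesComplex.ne5_of_ne5_reImTab` p225679, g35-e `…ComplexPointwise.ne5_of_pointwiseSlots_reIm`)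
take ONE chart `𝒰` carrying BOTH runs' backgrounds and a real section `ι : C.BgB → 𝒰`; the substrate's section of record is `sectionOfRecord D ι₀ :
C.BgB → TwoRunChart D o` (p224186), so at the instance `𝒰 := TwoRunChart D o` — run A's families read the factor `u.1`, run B's the factor `u.2` — and the
`hslice` binder of `OutputRateComplexSlice.operatorRate_complex_of_realSlice(_each)` (p225933) asks for ONE curve `γ : ℂ → TwoRunChart D o` along which
run A's family AND run B's family are holomorphic and bounded, with real diameter in `unitaryLev₂ D`.  That curve is the pair of p225653's discs at a
COMMON depth `r` and the COMMON base parameter `z₀ = I·r`.  (Typer (λ13): whether the NE5 owner instantiates at the pair chart or at a single-run chart with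
another section is the OWNER's choice — the substrate offers both: single factor p225653 ∕ p225952 ∕ W-15, pair this file; the species instances on the pair
are the follower W-17b.)

HONEST FRAMING: rung (B)+1 of the FINITE-VOLUME T⁴ programme — NOT infinite volume, NOT a mass gap, NOT Clay; spine PROVED 0∕9; NE5 NOT PRINTED ∕ NOT
proved.  Finite-dimensional chart GEOMETRY ([folklore]), 0 estimate; the families `FA`, `FB`, their radii `ρA`, `ρB` and bounds `CA`, `CB` are the
consumer's letters (at the substrate's species they are p223952's `rhoLev` ∕ `4∕γ` and W-15's `covBound`); the ℰ-families' letter and `hreal` stay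
DISPLAYED (θ8).  HONEST DEPENDENCY (cell line, verbatim): continuum YM on T⁴ ⇐ BetaPertH ∧ nine spine estimates (0/9 proved); BetaPertH ⇐ (D1) ∧ (D4) ∧
CAP+tail; G-an2-4 gates asym, D1 and NE2/3/4.

WHAT.  §1 `sliceDisc₂ D R⁰ A r z := (sliceDisc _ R⁰.1 A.1 r z, sliceDisc _ R⁰.2 A.2 r z)` (`_fst`, `_snd` rfl), `sliceDisc₂_I_mul` (through the pair of chart
points `pairPoint D R⁰ A := (expChartT _ R⁰.1 A.1, expChartT _ R⁰.2 A.2)` at `z₀ = I·r`), `sliceDisc₂_ofReal_mem_unitaryLev₂` (real diameter in the real slice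
of the pair chart, centre in `unitaryLev₂`); §2 **`hslice_sliceDisc₂_each`** — the SEVEN clauses of `operatorRate_complex_of_realSlice_each` for a run-A family
`u ↦ FA u.1` and a run-B family `u ↦ FB u.2` whose pull-backs along the exponential sub-charts are analytic and bounded on `ball 0 ρA` ∕ `ball 0 ρB`, at every
pair point with `(1 + r⁻¹)‖A.1‖ < ρA`, `(1 + r⁻¹)‖A.2‖ < ρB`; **`hslice_sliceDisc₂`** — the FIVE-clause difference form of `operatorRate_complex_of_realSlice`
(common target space, bound `CA + CB`); §3 `hslice_chi₂_each` — the same for families of the TWO-SIDED pairs read through `chi` on each factor (pull-backs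
rewritten by `chi_sliceDisc`); §4 `pairPoint_sectionOfRecord_zero` (every section point is the pair point of its own centre at `A = 0`) and
`hslice_sliceDisc₂_each_sectionOfRecord` (the package AT the section of record, smallness trivial).  The species instances on the pair (Green `4∕γ` per run
via p225952, covariance via W-15's `covBound`) are the follower W-17b, not here (keeps this cone at p225653).
-/

noncomputable section

open scoped BigOperators ComplexConjugate Matrix Matrix.Norms.L2Operator Kronecker ComplexOrder
open Complex (I)

namespace Summit.QuantumFields.BalabanUV.T4Continuum.SubstrateChartRealSlicePair

open Literature.MathematicalPhysics.QuantumFieldTheory.Balaban1983to89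
open Summit.QuantumFields.BalabanUV.T4Continuum
open Summit.QuantumFields.BalabanUV.T4Continuum.SubstrateTransporterSpecies
open Summit.QuantumFields.BalabanUV.T4Continuum.SubstrateTransporterSpeciesHolo (expChartT expChartInvT expChartT_zero)
open Summit.QuantumFields.BalabanUV.T4Continuum.SubstrateChartSection (chi sectionOfRecord TwoRunChart)
open Summit.QuantumFields.BalabanUV.T4Continuum.SubstrateChartRealSlice (unitaryLev sliceArg sliceDisc sliceDisc_I_mul sliceDisc_ofReal_mem_unitaryLev
  diffContOnCl_comp_sliceArg norm_comp_sliceArg_le chi_sliceDisc norm_I_mul_ofReal unitaryLev₂ sectionOfRecord_mem_unitaryLev₂)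
open Summit.QuantumFields.BalabanUV.T4Continuum.SubstrateTwoRunsDriven (DrivenRuns)

variable {G : Type} [GaugeGroup G] (D : DrivenRuns G) {o : Type} [Fintype o] [DecidableEq o]

/-! ## §1 The pair disc -/

/-- [folklore] **THE PAIR OF CHART POINTS** of a pair of centres and a pair of coordinates: `(expChartT _ R⁰.1 A.1, expChartT _ R⁰.2 A.2)`. -/
def pairPoint (R₀ A : TwoRunChart D o) : TwoRunChart D o := (expChartT _ R₀.1 A.1, expChartT _ R₀.2 A.2)

/-- [folklore] `rfl` view, run A. -/
theorem pairPoint_fst (R₀ A : TwoRunChart D o) : (pairPoint D R₀ A).1 = expChartT _ R₀.1 A.1 := rfl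

/-- [folklore] `rfl` view, run B. -/
theorem pairPoint_snd (R₀ A : TwoRunChart D o) : (pairPoint D R₀ A).2 = expChartT _ R₀.2 A.2 := rfl

/-- [folklore] **THE PAIR DISC** through `pairPoint D R⁰ A` at a COMMON depth `r`: p225653's `sliceDisc` on each factor with the same parameter `z`. -/
def sliceDisc₂ (R₀ A : TwoRunChart D o) (r : ℝ) (z : ℂ) : TwoRunChart D o :=
  (sliceDisc (D.F.P D.K) R₀.1 A.1 r z, sliceDisc (D.F.P (D.K + 1)) R₀.2 A.2 r z)

/-- [folklore] `rfl` view, run A. -/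
theorem sliceDisc₂_fst (R₀ A : TwoRunChart D o) (r : ℝ) (z : ℂ) : (sliceDisc₂ D R₀ A r z).1 = sliceDisc (D.F.P D.K) R₀.1 A.1 r z := rfl

/-- [folklore] `rfl` view, run B. -/
theorem sliceDisc₂_snd (R₀ A : TwoRunChart D o) (r : ℝ) (z : ℂ) : (sliceDisc₂ D R₀ A r z).2 = sliceDisc (D.F.P (D.K + 1)) R₀.2 A.2 r z := rfl

/-- [folklore] **THROUGH THE PAIR OF CHART POINTS AT THE COMMON PARAMETER `z₀ = I·r`** (`r ≠ 0`; `sliceDisc_I_mul` on each factor). -/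
theorem sliceDisc₂_I_mul (R₀ A : TwoRunChart D o) {r : ℝ} (hr : r ≠ 0) : sliceDisc₂ D R₀ A r (I * r) = pairPoint D R₀ A :=
  Prod.ext (sliceDisc_I_mul _ R₀.1 A.1 hr) (sliceDisc_I_mul _ R₀.2 A.2 hr)

/-- [folklore] **THE REAL DIAMETER LIES IN THE REAL SLICE OF THE PAIR CHART**: for a centre in `unitaryLev₂ D` and real `x`, both factors of `sliceDisc₂ D R⁰ A r x` are
unitary towers (`sliceDisc_ofReal_mem_unitaryLev` on each factor). -/
theorem sliceDisc₂_ofReal_mem_unitaryLev₂ {R₀ : TwoRunChart D o} (hR₀ : R₀ ∈ unitaryLev₂ D) (A : TwoRunChart D o) (r x : ℝ) :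
    sliceDisc₂ D R₀ A r x ∈ unitaryLev₂ D :=
  ⟨sliceDisc_ofReal_mem_unitaryLev _ hR₀.1 A.1 r x, sliceDisc_ofReal_mem_unitaryLev _ hR₀.2 A.2 r x⟩

/-- [folklore] The two-sided readings along the pair disc are the exponential pairs on each factor (`chi_sliceDisc`). -/
theorem chi_sliceDisc₂ {R₀ : TwoRunChart D o} (hR₀ : R₀ ∈ unitaryLev₂ D) (A : TwoRunChart D o) (r : ℝ) (z : ℂ) :
    chi _ (sliceDisc₂ D R₀ A r z).1 = (expChartT _ R₀.1 (sliceArg _ A.1 r z), expChartInvT _ R₀.1 (sliceArg _ A.1 r z)) ∧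
      chi _ (sliceDisc₂ D R₀ A r z).2 = (expChartT _ R₀.2 (sliceArg _ A.2 r z), expChartInvT _ R₀.2 (sliceArg _ A.2 r z)) :=
  ⟨chi_sliceDisc _ hR₀.1 A.1 r z, chi_sliceDisc _ hR₀.2 A.2 r z⟩

/-! ## §2 The `hslice` packages on the pair chart -/

section Packages

variable {R₀ : TwoRunChart D o} (hR₀ : R₀ ∈ unitaryLev₂ D)

include hR₀ in
/-- [folklore] **THE SEVEN-CLAUSE PACKAGE** (the `hslice` binder of `OutputRateComplexSlice.operatorRate_complex_of_realSlice_each` at `𝒰 := TwoRunChart D o`,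
`real := unitaryLev₂ D`, `opA g k u := FA u.1`, `opB g k u := FB u.2`): for a centre in the real slice, a common depth `0 < r`, a run-A family `FA` and a run-B family
`FB` on GLOBAL tower points whose pull-backs along the exponential sub-charts at `R⁰.1` ∕ `R⁰.2` are analytic and `CA`- ∕ `CB`-bounded on `ball 0 ρA` ∕ `ball 0 ρB`,
and a pair of coordinates with `(1 + r⁻¹)·‖A.1‖ < ρA`, `(1 + r⁻¹)·‖A.2‖ < ρB`: the pair disc `γ := sliceDisc₂ D R⁰ A r` and `z₀ := I·r` witness
`‖z₀‖ ≤ r ∧ γ z₀ = pairPoint D R⁰ A ∧ (real diameter ⊆ unitaryLev₂) ∧ DiffContOnCl (FA ∘ (·.1) ∘ γ) ∧ DiffContOnCl (FB ∘ (·.2) ∘ γ) ∧ both closed-disc bounds`. -/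
theorem hslice_sliceDisc₂_each {EA EB : Type*} [NormedAddCommGroup EA] [NormedSpace ℂ EA] [NormedAddCommGroup EB] [NormedSpace ℂ EB]
    (FA : TowerData (D.F.P D.K) o → EA) (FB : TowerData (D.F.P (D.K + 1)) o → EB) {ρA ρB CA CB r : ℝ} (hr : 0 < r)
    (hanA : AnalyticOnNhd ℂ (fun B => FA (expChartT _ R₀.1 B)) (Metric.ball 0 ρA))
    (hbdA : ∀ B ∈ Metric.ball 0 ρA, ‖FA (expChartT _ R₀.1 B)‖ ≤ CA)
    (hanB : AnalyticOnNhd ℂ (fun B => FB (expChartT _ R₀.2 B)) (Metric.ball 0 ρB))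
    (hbdB : ∀ B ∈ Metric.ball 0 ρB, ‖FB (expChartT _ R₀.2 B)‖ ≤ CB)
    (A : TwoRunChart D o) (hA1 : (1 + r⁻¹) * ‖A.1‖ < ρA) (hA2 : (1 + r⁻¹) * ‖A.2‖ < ρB) :
    ∃ γ : ℂ → TwoRunChart D o, ∃ z₀ : ℂ, ‖z₀‖ ≤ r ∧ γ z₀ = pairPoint D R₀ A ∧ (∀ x : ℝ, |x| < 1 → γ x ∈ unitaryLev₂ D) ∧
      DiffContOnCl ℂ (fun z => FA (γ z).1) (Metric.ball (0 : ℂ) 1) ∧ DiffContOnCl ℂ (fun z => FB (γ z).2) (Metric.ball (0 : ℂ) 1) ∧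
      (∀ z : ℂ, ‖z‖ ≤ 1 → ‖FA (γ z).1‖ ≤ CA) ∧ ∀ z : ℂ, ‖z‖ ≤ 1 → ‖FB (γ z).2‖ ≤ CB :=
  ⟨sliceDisc₂ D R₀ A r, I * r, by rw [norm_I_mul_ofReal, abs_of_pos hr], sliceDisc₂_I_mul D R₀ A hr.ne',
    fun x _ => sliceDisc₂_ofReal_mem_unitaryLev₂ D hR₀ A r x,
    diffContOnCl_comp_sliceArg _ (F := fun B => FA (expChartT _ R₀.1 B)) hanA A.1 hr hA1,
    diffContOnCl_comp_sliceArg _ (F := fun B => FB (expChartT _ R₀.2 B)) hanB A.2 hr hA2,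
    fun _ hz => norm_comp_sliceArg_le _ (F := fun B => FA (expChartT _ R₀.1 B)) hbdA A.1 hr hA1 hz,
    fun _ hz => norm_comp_sliceArg_le _ (F := fun B => FB (expChartT _ R₀.2 B)) hbdB A.2 hr hA2 hz⟩

include hR₀ in
/-- [folklore] **THE FIVE-CLAUSE DIFFERENCE FORM** (the `hslice` binder of `operatorRate_complex_of_realSlice` at the pair chart; common target space): along
the pair disc the DIFFERENCE `FA (γ z).1 − FB (γ z).2` is `DiffContOnCl` on the unit disc and bounded by `CA + CB` on the closed disc. -/
theorem hslice_sliceDisc₂ {E : Type*} [NormedAddCommGroup E] [NormedSpace ℂ E]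
    (FA : TowerData (D.F.P D.K) o → E) (FB : TowerData (D.F.P (D.K + 1)) o → E) {ρA ρB CA CB r : ℝ} (hr : 0 < r)
    (hanA : AnalyticOnNhd ℂ (fun B => FA (expChartT _ R₀.1 B)) (Metric.ball 0 ρA))
    (hbdA : ∀ B ∈ Metric.ball 0 ρA, ‖FA (expChartT _ R₀.1 B)‖ ≤ CA)
    (hanB : AnalyticOnNhd ℂ (fun B => FB (expChartT _ R₀.2 B)) (Metric.ball 0 ρB))
    (hbdB : ∀ B ∈ Metric.ball 0 ρB, ‖FB (expChartT _ R₀.2 B)‖ ≤ CB)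
    (A : TwoRunChart D o) (hA1 : (1 + r⁻¹) * ‖A.1‖ < ρA) (hA2 : (1 + r⁻¹) * ‖A.2‖ < ρB) :
    ∃ γ : ℂ → TwoRunChart D o, ∃ z₀ : ℂ, ‖z₀‖ ≤ r ∧ γ z₀ = pairPoint D R₀ A ∧ (∀ x : ℝ, |x| < 1 → γ x ∈ unitaryLev₂ D) ∧
      DiffContOnCl ℂ (fun z => FA (γ z).1 - FB (γ z).2) (Metric.ball (0 : ℂ) 1) ∧
      ∀ z : ℂ, ‖z‖ ≤ 1 → ‖FA (γ z).1 - FB (γ z).2‖ ≤ CA + CB := by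
  obtain ⟨γ, z₀, hz₀, hγu, hreal, hdA, hdB, hbA, hbB⟩ := hslice_sliceDisc₂_each D hR₀ FA FB hr hanA hbdA hanB hbdB A hA1 hA2
  exact ⟨γ, z₀, hz₀, hγu, hreal, hdA.sub hdB, fun z hz => (norm_sub_le _ _).trans (add_le_add (hbA z hz) (hbB z hz))⟩

include hR₀ in
/-- [folklore] **THE SEVEN-CLAUSE PACKAGE FOR FAMILIES OF THE TWO-SIDED PAIRS READ THROUGH `chi` ON EACH FACTOR** (the substrate's species are functions of the
pair `(R, S)`; on global tower points they are read through `chi`): pull-backs along the exponential pairs, rewritten by `chi_sliceDisc`. -/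
theorem hslice_chi₂_each {EA EB : Type*} [NormedAddCommGroup EA] [NormedSpace ℂ EA] [NormedAddCommGroup EB] [NormedSpace ℂ EB]
    (GA : TowerData (D.F.P D.K) o × TowerData (D.F.P D.K) o → EA) (GB : TowerData (D.F.P (D.K + 1)) o × TowerData (D.F.P (D.K + 1)) o → EB)
    {ρA ρB CA CB r : ℝ} (hr : 0 < r)
    (hanA : AnalyticOnNhd ℂ (fun B => GA (expChartT _ R₀.1 B, expChartInvT _ R₀.1 B)) (Metric.ball 0 ρA))
    (hbdA : ∀ B ∈ Metric.ball 0 ρA, ‖GA (expChartT _ R₀.1 B, expChartInvT _ R₀.1 B)‖ ≤ CA)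
    (hanB : AnalyticOnNhd ℂ (fun B => GB (expChartT _ R₀.2 B, expChartInvT _ R₀.2 B)) (Metric.ball 0 ρB))
    (hbdB : ∀ B ∈ Metric.ball 0 ρB, ‖GB (expChartT _ R₀.2 B, expChartInvT _ R₀.2 B)‖ ≤ CB)
    (A : TwoRunChart D o) (hA1 : (1 + r⁻¹) * ‖A.1‖ < ρA) (hA2 : (1 + r⁻¹) * ‖A.2‖ < ρB) :
    ∃ γ : ℂ → TwoRunChart D o, ∃ z₀ : ℂ, ‖z₀‖ ≤ r ∧ γ z₀ = pairPoint D R₀ A ∧ (∀ x : ℝ, |x| < 1 → γ x ∈ unitaryLev₂ D) ∧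
      DiffContOnCl ℂ (fun z => GA (chi _ (γ z).1)) (Metric.ball (0 : ℂ) 1) ∧ DiffContOnCl ℂ (fun z => GB (chi _ (γ z).2)) (Metric.ball (0 : ℂ) 1) ∧
      (∀ z : ℂ, ‖z‖ ≤ 1 → ‖GA (chi _ (γ z).1)‖ ≤ CA) ∧ ∀ z : ℂ, ‖z‖ ≤ 1 → ‖GB (chi _ (γ z).2)‖ ≤ CB := by
  have h1 : (fun z : ℂ => GA (chi _ (sliceDisc₂ D R₀ A r z).1)) = fun z => GA (expChartT _ R₀.1 (sliceArg _ A.1 r z), expChartInvT _ R₀.1 (sliceArg _ A.1 r z)) :=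
    funext fun z => by rw [(chi_sliceDisc₂ D hR₀ A r z).1]
  have h2 : (fun z : ℂ => GB (chi _ (sliceDisc₂ D R₀ A r z).2)) = fun z => GB (expChartT _ R₀.2 (sliceArg _ A.2 r z), expChartInvT _ R₀.2 (sliceArg _ A.2 r z)) :=
    funext fun z => by rw [(chi_sliceDisc₂ D hR₀ A r z).2]
  refine ⟨sliceDisc₂ D R₀ A r, I * r, by rw [norm_I_mul_ofReal, abs_of_pos hr], sliceDisc₂_I_mul D R₀ A hr.ne',
    fun x _ => sliceDisc₂_ofReal_mem_unitaryLev₂ D hR₀ A r x, ?_, ?_, fun z hz => ?_, fun z hz => ?_⟩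
  · rw [h1]; exact diffContOnCl_comp_sliceArg _ (F := fun B => GA (expChartT _ R₀.1 B, expChartInvT _ R₀.1 B)) hanA A.1 hr hA1
  · rw [h2]; exact diffContOnCl_comp_sliceArg _ (F := fun B => GB (expChartT _ R₀.2 B, expChartInvT _ R₀.2 B)) hanB A.2 hr hA2
  · rw [show GA (chi _ (sliceDisc₂ D R₀ A r z).1) = (fun z : ℂ => GA (chi _ (sliceDisc₂ D R₀ A r z).1)) z from rfl, h1]
    exact norm_comp_sliceArg_le _ (F := fun B => GA (expChartT _ R₀.1 B, expChartInvT _ R₀.1 B)) hbdA A.1 hr hA1 hz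
  · rw [show GB (chi _ (sliceDisc₂ D R₀ A r z).2) = (fun z : ℂ => GB (chi _ (sliceDisc₂ D R₀ A r z).2)) z from rfl, h2]
    exact norm_comp_sliceArg_le _ (F := fun B => GB (expChartT _ R₀.2 B, expChartInvT _ R₀.2 B)) hbdB A.2 hr hA2 hz

end Packages

/-! ## §3 At the section of record -/

section Record

variable (ι : G →* Matrix o o ℂ)

/-- [folklore] **EVERY SECTION POINT IS THE PAIR POINT OF ITS OWN CENTRE AT `A = 0`** (`expChartT_zero` on each factor). -/
theorem pairPoint_sectionOfRecord_zero (U : D.carriers.BgB) : pairPoint D (sectionOfRecord D ι U) 0 = sectionOfRecord D ι U :=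
  Prod.ext (expChartT_zero _ _) (expChartT_zero _ _)

/-- [folklore] **THE SEVEN-CLAUSE PACKAGE AT A SECTION POINT** (unitary `ι`; centre := the section point itself, `A = 0`, so the smallness is `0 < ρA`, `0 < ρB`):
the disc through `sectionOfRecord D ι U` along which a run-A family and a run-B family — analytic and bounded on the chart balls centred AT the section point —
are holomorphic and bounded, real diameter in `unitaryLev₂ D`. -/
theorem hslice_sliceDisc₂_each_sectionOfRecord (hι : ∀ g, ι g ∈ Matrix.unitaryGroup o ℂ) (U : D.carriers.BgB)
    {EA EB : Type*} [NormedAddCommGroup EA] [NormedSpace ℂ EA] [NormedAddCommGroup EB] [NormedSpace ℂ EB]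
    (FA : TowerData (D.F.P D.K) o → EA) (FB : TowerData (D.F.P (D.K + 1)) o → EB) {ρA ρB CA CB r : ℝ} (hr : 0 < r) (hρA : 0 < ρA) (hρB : 0 < ρB)
    (hanA : AnalyticOnNhd ℂ (fun B => FA (expChartT _ (sectionOfRecord D ι U).1 B)) (Metric.ball 0 ρA))
    (hbdA : ∀ B ∈ Metric.ball 0 ρA, ‖FA (expChartT _ (sectionOfRecord D ι U).1 B)‖ ≤ CA)
    (hanB : AnalyticOnNhd ℂ (fun B => FB (expChartT _ (sectionOfRecord D ι U).2 B)) (Metric.ball 0 ρB))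
    (hbdB : ∀ B ∈ Metric.ball 0 ρB, ‖FB (expChartT _ (sectionOfRecord D ι U).2 B)‖ ≤ CB) :
    ∃ γ : ℂ → TwoRunChart D o, ∃ z₀ : ℂ, ‖z₀‖ ≤ r ∧ γ z₀ = sectionOfRecord D ι U ∧ (∀ x : ℝ, |x| < 1 → γ x ∈ unitaryLev₂ D) ∧
      DiffContOnCl ℂ (fun z => FA (γ z).1) (Metric.ball (0 : ℂ) 1) ∧ DiffContOnCl ℂ (fun z => FB (γ z).2) (Metric.ball (0 : ℂ) 1) ∧
      (∀ z : ℂ, ‖z‖ ≤ 1 → ‖FA (γ z).1‖ ≤ CA) ∧ ∀ z : ℂ, ‖z‖ ≤ 1 → ‖FB (γ z).2‖ ≤ CB := by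
  have h := hslice_sliceDisc₂_each D (sectionOfRecord_mem_unitaryLev₂ D ι hι U) FA FB hr hanA hbdA hanB hbdB 0
    (by rw [Prod.fst_zero, norm_zero, mul_zero]; exact hρA) (by rw [Prod.snd_zero, norm_zero, mul_zero]; exact hρB)
  rwa [pairPoint_sectionOfRecord_zero] at h

end Record

end Summit.QuantumFields.BalabanUV.T4Continuum.SubstrateChartRealSlicePair

end
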